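import Summits.QuantumFields.QCD.Theorems.QuarksAsStableActionSmallHoppingDiamagnetismDefs

/-!
# Small-hopping diamagnetism (stmt-QuantumFields-9738): the hopping (random-walk) expansion

For a gauge field `V` on the four-torus and a matrix representation `ρ`:

* `hopLetter_apply` : entries of the single-hop matrices (`wilsonHopFwd` / `wilsonHopBwd` at
  `r = 1`) in terms of `spinMat`, `link`, `stepVec`;
* `wordMat_apply` : entries of an ordered product of hop matrices along a word `w`:
  `[y = x + disp w] · (spinWord w)_{αβ} · ρ(hol V x w)_{ab}`;
* `trace_wordMat` : `tr (wordMat w) = [disp w = 0] · tr (spinWord w) · Σ_x tr ρ(hol V x w)`;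
* `hopMatrix_pow`, `trace_hopMatrix_pow` : `H ^ k = Σ_{|w| = k} wordMat w` and its trace;
* `wilsonDirac_eq_smul_one_sub` : `D_W(m, r=1) = (m + 4) • (1 - κ H)`, `κ = (2m + 8)⁻¹`.
-/

noncomputable section

namespace Summit.QuantumFields.QCD.Theorems.SmallHopping

open Literature.Probability.LatticeModels Literature.MathematicalPhysics.QuantumLattice
  Literature.MathematicalPhysics.QuantumFieldTheory Matrix

variable {L N : ℕ} {G : Type*} [Group G] (ρ : G →* Matrix (Fin N) (Fin N) ℂ)

/-! ## Unfolding lemmas -/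

section Unfold

omit ρ

/-- `hol` of the empty word. -/
@[simp] theorem hol_nil (V : GaugeConfig 4 L G) (x : TorusSite 4 L) : hol V x [] = 1 := rfl

/-- `hol` of a word with a first letter. -/
@[simp] theorem hol_cons (V : GaugeConfig 4 L G) (x : TorusSite 4 L) (l : Letter) (w : List Letter) :
    hol V x (l :: w) = link V x l * hol V (x + stepVec l) w := rfl

/-- `disp` of the empty word. -/
@[simp] theorem disp_nil : disp ([] : List Letter) = (0 : TorusSite 4 L) := by simp [disp]

/-- `disp` of a word with a first letter. -/
@[simp] theorem disp_cons (l : Letter) (w : List Letter) :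
    disp (l :: w) = (stepVec l : TorusSite 4 L) + disp w := by simp [disp]

/-- `spinWord` of the empty word. -/
@[simp] theorem spinWord_nil : spinWord [] = 1 := by simp [spinWord]

/-- `spinWord` of a word with a first letter. -/
@[simp] theorem spinWord_cons (l : Letter) (w : List Letter) :
    spinWord (l :: w) = spinMat l * spinWord w := by simp [spinWord]

/-- The step of the inverse letter is the opposite step. -/
@[simp] theorem stepVec_inv (l : Letter) : (stepVec l.inv : TorusSite 4 L) = -stepVec l := by
  obtain ⟨μ, b⟩ := l
  cases b <;> simp [stepVec, Letter.inv]

/-- Backtracking: the link picked up by the inverse letter from the endpoint is the inverse link. -/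
theorem link_inv (V : GaugeConfig 4 L G) (x : TorusSite 4 L) (l : Letter) :
    link V (x + stepVec l) l.inv = (link V x l)⁻¹ := by
  obtain ⟨μ, b⟩ := l
  cases b <;> simp [link, stepVec, Letter.inv, sub_eq_add_neg]

/-- Backtracking cancels: `hol x (l :: l⁻¹ :: w) = hol x w`. -/
theorem hol_cons_inv_cons (V : GaugeConfig 4 L G) (x : TorusSite 4 L) (l : Letter)
    (w : List Letter) : hol V x (l :: l.inv :: w) = hol V x w := by
  simp [link_inv]

end Unfold

/-! ## Entries of the hop and word matrices -/

/-- Entries of the hop matrix of a letter: a hop from `x` along `l` lands at `x + step l`, with spin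
factor `spinMat l` and colour factor `ρ (link V x l)`. -/
theorem hopLetter_apply (V : GaugeConfig 4 L G) (l : Letter)
    (p q : TorusSite 4 L × Fin N × Fin 4) :
    hopLetter ρ V l p q =
      if q.1 = p.1 + stepVec l then spinMat l p.2.2 q.2.2 * ρ (link V p.1 l) p.2.1 q.2.1 else 0 := by
  obtain ⟨μ, b⟩ := l
  cases b
  · -- backward hop
    have hiff : (p.1 = Literature.MathematicalPhysics.QuantumFieldTheory.Site.shift q.1 μ) ↔
        (q.1 = p.1 + -Pi.single μ 1) := by
      simp only [Literature.MathematicalPhysics.QuantumFieldTheory.Site.shift]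
      constructor
      · rintro h; rw [h, add_neg_cancel_right]
      · rintro h; rw [h, neg_add_cancel_right]
    simp only [hopLetter, Bool.false_eq_true, ↓reduceIte, wilsonHopBwd, Matrix.of_apply, hiff,
      stepVec, spinMat, link, Complex.ofReal_one, one_smul]
    by_cases h : q.1 = p.1 + -Pi.single μ 1
    · rw [if_pos h, if_pos h, h, ← sub_eq_add_neg]
    · rw [if_neg h, if_neg h]
  · -- forward hop
    simp only [hopLetter, ↓reduceIte, wilsonHopFwd, Matrix.of_apply,
      Literature.MathematicalPhysics.QuantumFieldTheory.Site.shift, stepVec, spinMat, link,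
      Complex.ofReal_one, one_smul]

section Words

variable [NeZero L]

/-- `wordMat` of the empty word. -/
@[simp] theorem wordMat_nil (V : GaugeConfig 4 L G) : wordMat ρ V [] = 1 := by simp [wordMat]

/-- `wordMat` of a word with a first letter. -/
@[simp] theorem wordMat_cons (V : GaugeConfig 4 L G) (l : Letter) (w : List Letter) :
    wordMat ρ V (l :: w) = hopLetter ρ V l * wordMat ρ V w := by simp [wordMat]

/-- **Entries of the word matrices** (random-walk representation): the `(p, q)` entry of the
ordered product of hop matrices along `w` vanishes unless `q` sits at `p + disp w`, where it is
the spin factor `(spinWord w)_{αβ}` times the colour transporter `ρ(hol V x w)_{ab}`. -/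
theorem wordMat_apply (V : GaugeConfig 4 L G) (w : List Letter)
    (p q : TorusSite 4 L × Fin N × Fin 4) :
    wordMat ρ V w p q =
      if q.1 = p.1 + disp w then spinWord w p.2.2 q.2.2 * ρ (hol V p.1 w) p.2.1 q.2.1 else 0 := by
  induction w generalizing p q with
  | nil =>
    obtain ⟨x, a, α⟩ := p
    obtain ⟨y, b, β⟩ := q
    simp only [wordMat_nil, disp_nil, add_zero, spinWord_nil, hol_nil, map_one, Matrix.one_apply,
      Prod.mk.injEq]
    by_cases hxy : x = y
    · subst hxy
      by_cases hαβ : α = β <;> by_cases hab : a = b <;> simp [hαβ, hab]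
    · rw [if_neg (fun h => hxy h.1), if_neg (fun h => hxy h.symm)]
  | cons l w ih =>
    rw [wordMat_cons, Matrix.mul_apply]
    simp_rw [hopLetter_apply, ih]
    rw [Fintype.sum_prod_type, Finset.sum_eq_single (p.1 + stepVec l)]
    · simp only [if_true]
      by_cases hq : q.1 = p.1 + disp (l :: w)
      · have hq' : q.1 = p.1 + stepVec l + disp w := by rw [hq, disp_cons, add_assoc]
        simp only [hq', if_true]
        rw [if_pos (by rw [disp_cons, add_assoc]), spinWord_cons, hol_cons, map_mul, Matrix.mul_apply,
          Matrix.mul_apply, Fintype.sum_prod_type, Finset.sum_mul_sum, Finset.sum_comm]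
        refine Finset.sum_congr rfl fun β _ => Finset.sum_congr rfl fun b _ => ?_
        ring
      · have hq' : ¬ q.1 = p.1 + stepVec l + disp w := by rwa [disp_cons, ← add_assoc] at hq
        simp only [hq', if_false, mul_zero, Finset.sum_const_zero]
        rw [if_neg hq]
    · intro y _ hy
      simp only [hy, if_false, zero_mul, Finset.sum_const_zero]
    · intro h; exact absurd (Finset.mem_univ _) h

/-- **Trace of a word matrix**: zero unless the word is closed on the torus (`disp w = 0`), and then
`tr (spinWord w) · Σ_x tr ρ(hol V x w)`. -/
theorem trace_wordMat (V : GaugeConfig 4 L G) (w : List Letter) :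
    (wordMat ρ V w).trace =
      if disp w = (0 : TorusSite 4 L) then
        (spinWord w).trace * ∑ x : TorusSite 4 L, (ρ (hol V x w)).trace
      else 0 := by
  simp only [Matrix.trace, Matrix.diag, wordMat_apply, Fintype.sum_prod_type]
  have hiff : ∀ x : TorusSite 4 L, (x = x + disp w) ↔ disp w = (0 : TorusSite 4 L) := fun x =>
    ⟨fun h => by simpa using h.symm, fun h => by simp [h]⟩
  simp only [hiff]
  by_cases h : disp w = (0 : TorusSite 4 L)
  · simp only [h, if_true, Finset.mul_sum, Finset.sum_mul]
  · simp [h]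

/-! ## Powers of the hopping matrix -/

/-- **Random-walk expansion of `H ^ k`**: the sum of the word matrices of all words of length `k`. -/
theorem hopMatrix_pow (V : GaugeConfig 4 L G) (k : ℕ) :
    hopMatrix ρ V ^ k = ∑ w : Fin k → Letter, wordMat ρ V (List.ofFn w) := by
  induction k with
  | zero => simp
  | succ k ih =>
    rw [pow_succ', ih, hopMatrix, Finset.sum_mul]
    simp_rw [Finset.mul_sum, ← wordMat_cons]
    rw [← Fintype.sum_prod_type']
    exact Fintype.sum_equiv (Fin.consEquiv fun _ => Letter) _ _ (fun x => by
      simp [Fin.consEquiv])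

/-- **Trace of `H ^ k`** as a sum over closed words of length `k`. -/
theorem trace_hopMatrix_pow (V : GaugeConfig 4 L G) (k : ℕ) :
    (hopMatrix ρ V ^ k).trace =
      ∑ w : Fin k → Letter,
        if disp (List.ofFn w) = (0 : TorusSite 4 L) then
          (spinWord (List.ofFn w)).trace * ∑ x : TorusSite 4 L, (ρ (hol V x (List.ofFn w))).trace
        else 0 := by
  rw [hopMatrix_pow, Matrix.trace_sum]
  simp_rw [trace_wordMat]

end Words

/-! ## The Wilson–Dirac operator as `(m + 4)(1 - κ H)` -/

/-- `hopMatrix = Σ_μ (H⁺_μ + H⁻_μ)`. -/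
theorem hopMatrix_eq_sum (V : GaugeConfig 4 L G) :
    hopMatrix ρ V = ∑ μ : Fin 4, (wilsonHopFwd ρ V 1 μ + wilsonHopBwd ρ V 1 μ) := by
  rw [hopMatrix, Fintype.sum_prod_type]
  refine Finset.sum_congr rfl fun μ _ => ?_
  rw [Fintype.sum_bool]
  simp [hopLetter]

/-- **`D_W = (m + 4) • (1 - κ H)`** at `r = 1`, with `κ = (2m + 8)⁻¹` (for `m + 4 ≠ 0`). -/
theorem wilsonDirac_eq_smul_one_sub (V : GaugeConfig 4 L G) (m : ℝ) (hm : m + 4 ≠ 0) :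
    wilsonDirac ρ V m 1 =
      ((m + 4 : ℝ) : ℂ) • ((1 : Matrix _ _ ℂ) - (((2 * m + 8)⁻¹ : ℝ) : ℂ) • hopMatrix ρ V) := by
  rw [wilsonDirac_eq, hopMatrix_eq_sum, smul_sub, smul_smul, mul_one]
  congr 1
  have h : ((m + 4 : ℝ) : ℂ) * (((2 * m + 8)⁻¹ : ℝ) : ℂ) = (1 / 2 : ℂ) := by
    have h1 : (m + 4) * (2 * m + 8)⁻¹ = 1 / 2 := by
      rw [show (2 * m + 8 : ℝ) = 2 * (m + 4) by ring, mul_inv, ← mul_assoc, mul_comm (m + 4),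
        mul_assoc, mul_inv_cancel₀ hm, mul_one, one_div]
    rw [← Complex.ofReal_mul, h1]
    push_cast
    ring
  rw [h]

/-- Consequently `det D_W = (m + 4)^{dim} · det (1 - κ H)`. -/
theorem det_wilsonDirac [NeZero L] (V : GaugeConfig 4 L G) (m : ℝ) (hm : m + 4 ≠ 0) :
    (wilsonDirac ρ V m 1).det =
      ((m + 4 : ℝ) : ℂ) ^ Fintype.card (TorusSite 4 L × Fin N × Fin 4) *
        ((1 : Matrix _ _ ℂ) - (((2 * m + 8)⁻¹ : ℝ) : ℂ) • hopMatrix ρ V).det := by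
  rw [wilsonDirac_eq_smul_one_sub ρ V m hm, Matrix.det_smul]

end Summit.QuantumFields.QCD.Theorems.SmallHopping
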